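import Mathlib
import HarnessLib
import Summits.CriticalPhenomena.PercolationContinuityZ3.Theorems.PercNearOneGluingNoHeavyLowerTailTwoCopyLadderAllGradesSide

/-!
# Rails of ALL ladders at ALL grades (sequel to `…TwoCopyLadderAllGradesSide`)

Helper file for crux `stmt-CriticalPhenomena-4575` (new-inequality factory `prim-ineq-gen-1`, gen 19); memo
`run/shared/lean/prim/prim-ineq-gen-1/FINDING-26-all-grades-spokes-rails.md`.  The all-grade RAIL form `Frail q X Y`
(`= P_{L_r+av; av, u_ju_{j+1}}/q³` in the q-weighted types of the two sides of the cut `{u_{j+1}, w_{j+1}}`; 94 monomials, symmetric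
in `X ↔ Y`, `Frail 0 = Brail` of gen 18), its exact behaviour under the four q-moves on the first argument —
`Frail (rungStep t X) Y = Frail X Y + t(C+qM)(C+qD)·Aq X + m₁·Aq Y + m₂·Dl Y + N`, `Frail (qpendU ρ X) Y = ρ(ρ+q)·Frail X Y`,
`Frail (qpendW ρ X) Y = ρ²·Frail X Y + N'`, `Frail (mergeUW X) Y = m₃·Aq Y`, `Frail triv Y = Aq Y` (multipliers and remainders with
nonnegative integer coefficients, found by exact linear programming and checked by `ring`) — and hence `Frail q X Y ∈ P` for every
positive cone `P ∋ q` and all `X, Y` in the orbit `Orb` (`Frail_pos`); instances: `0 ≤ ·` for real `q ≥ 0` (Rayleigh negative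
correlation of the apex edge with every rail of every ladder at every `0 < q < 1`, `rail_allq_nonneg`) and q-coefficients
(the graded CONJ-L edge shadow for rails, `rail_coeff_nonneg`).  Not formalised: the identification with the graph polynomials
(memo §1; validated for `r ≤ 3` as exact identities).  (This work, 2026-08-21.)
-/

namespace Summit.CriticalPhenomena.PercolationContinuityZ3.Theorems

namespace TwoCopyLadderAllGrades

open TwoCopyLadderCubic

variable {R : Type*} [CommRing R]

/-- The all-grade RAIL form `P_{av, u_ju_{j+1}}/q³` (cut `{u_{j+1}, w_{j+1}}`; `X` = q-types of the apex side over `(a; u_j, w_{j+1})`,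
`Y` = q-types of the other side over `(v; u_{j+1}, w_{j+1})`; copy B merges `u_j ~ u_{j+1}`; 94 monomials, memo §3), written grouped
by the monomials of `X`. [this work] -/
def Frail (q : R) (X Y : SVec R) : R :=
  X.m * X.d * ((1 - q) * (Y.c + q * Y.m) * (Y.c + q * Y.d))
    + (q * X.p * X.s + X.p * X.d + X.p * X.m + X.p ^ 2) * C0q q Y
    + X.c * X.s * (q ^ 2 * Y.p * (Y.c + Y.p + Y.m + Y.d + q * Y.s) - (1 - q) * Y.c * (Y.c + q * Y.d + q * Y.m + q ^ 2 * Y.s))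
    + q * (X.c * X.d + X.c * X.m) * Aq q Y + X.c * X.p * Bq q Y + X.c ^ 2 * Aq q Y

/-- The rail form is symmetric under exchanging the two sides. [this work] -/
theorem Frail_symm (q : R) (X Y : SVec R) : Frail q X Y = Frail q Y X := by
  unfold Frail Aq Bq C0q; ring

/-- At `q = 0` the all-grade rail form is the q³ rail form `Brail` of gen 18. [this work] -/
theorem Frail_zero (X Y : SVec R) : Frail 0 X Y = Brail X Y := by
  unfold Frail Brail Aq Bq C0q sigma; ring

/-- On the one-vertex side the rail form is the side form of the other side. [this work] -/
theorem Frail_triv (q : R) (Y : SVec R) : Frail q triv Y = Aq q Y := by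
  unfold Frail triv Aq; ring

/-- The rail form under a terminal rung on the first side: old form plus nonnegative multiples of `Aq X`, `Aq Y`, `Dl Y` plus a polynomial with nonnegative coefficients (multipliers found by exact LP). [this work] -/
theorem Frail_rungStep (q t : R) (X Y : SVec R) :
    Frail q (rungStep t X) Y = Frail q X Y + (q ^ 2 * t * Y.m * Y.d + q * t * Y.c * Y.d + q * t * Y.c * Y.m
      + t * Y.c ^ 2) * Aq q X + (q * t ^ 2 * X.m * X.s + q * t ^ 2 * X.m * X.d + q * t ^ 2 * X.p * X.s
      + q * t ^ 2 * X.p * X.d + q * t ^ 2 * X.c * X.s + q * t ^ 2 * X.c * X.d + q ^ 2 * t * X.m * X.s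
      + q ^ 2 * t * X.p * X.s + q ^ 2 * t * X.c * X.s + t ^ 2 * X.m ^ 2 + 2 * t ^ 2 * X.p * X.m + t ^ 2 * X.p ^ 2
      + 2 * t ^ 2 * X.c * X.m + 2 * t ^ 2 * X.c * X.p + t ^ 2 * X.c ^ 2 + q * t * X.m * X.d + q * t * X.m ^ 2
      + q * t * X.p * X.d + 2 * q * t * X.p * X.m + q * t * X.p ^ 2 + q * t * X.c * X.s + 2 * q * t * X.c * X.d
      + q * t * X.c * X.m + q * t * X.c * X.p + 2 * t * X.c * X.m + 2 * t * X.c * X.p + 2 * t * X.c ^ 2) * Aq q Y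
      + (q ^ 2 * t * X.p * X.s + q ^ 2 * t * X.p * X.d + q * t * X.p * X.m + q * t * X.p ^ 2
      + q * t * X.c * X.p) * Dl Y + (q ^ 3 * t * X.p * X.s * Y.p * Y.s + q ^ 3 * t * X.p * X.d * Y.p * Y.s
      + q ^ 2 * t * X.p * X.s * Y.p * Y.d + q ^ 2 * t * X.p * X.s * Y.p * Y.m + q ^ 2 * t * X.p * X.s * Y.p ^ 2
      + q ^ 2 * t * X.p * X.d * Y.p * Y.d + q ^ 2 * t * X.p * X.d * Y.p * Y.m + q ^ 2 * t * X.p * X.d * Y.p ^ 2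
      + q ^ 2 * t * X.p * X.m * Y.p * Y.s + q ^ 2 * t * X.p ^ 2 * Y.p * Y.s + q ^ 2 * t * X.c * X.p * Y.p * Y.s
      + 2 * q * t * X.p * X.s * Y.c * Y.p + 2 * q * t * X.p * X.d * Y.c * Y.p + q * t * X.p * X.m * Y.p * Y.d
      + q * t * X.p * X.m * Y.p * Y.m + q * t * X.p * X.m * Y.p ^ 2 + q * t * X.p ^ 2 * Y.p * Y.d
      + q * t * X.p ^ 2 * Y.p * Y.m + q * t * X.p ^ 2 * Y.p ^ 2 + q * t * X.c * X.p * Y.p * Y.d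
      + q * t * X.c * X.p * Y.p * Y.m + q * t * X.c * X.p * Y.p ^ 2 + 2 * t * X.p * X.m * Y.c * Y.p
      + 2 * t * X.p ^ 2 * Y.c * Y.p + 2 * t * X.c * X.p * Y.c * Y.p) := by
  unfold Frail Aq Bq C0q Dl rungStep; ring

/-- The rail form under a pendant edge at `u` on the first side scales exactly by `ρ(ρ+q)`. [this work] -/
theorem Frail_qpendU (q ρ : R) (X Y : SVec R) :
    Frail q (qpendU q ρ X) Y = (ρ ^ 2 + q * ρ) * Frail q X Y := by
  unfold Frail Aq Bq C0q qpendU; ring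

/-- Part 1 of the (171-monomial, nonnegative) remainder in `Frail_qpendW` (chunked for elaboration). [this work] -/
def FpendWN1 (q ρ : R) (X Y : SVec R) : R :=
  2 * q ^ 5 * ρ * X.p * X.s * Y.p * Y.s + q ^ 6 * X.p * X.s * Y.p * Y.s + 2 * q ^ 4 * ρ * X.p * X.s * Y.p * Y.d
    + 2 * q ^ 4 * ρ * X.p * X.s * Y.p * Y.m + 2 * q ^ 4 * ρ * X.p * X.s * Y.p ^ 2
    + 2 * q ^ 4 * ρ * X.p * X.s * Y.c * Y.s + 2 * q ^ 4 * ρ * X.p * X.d * Y.p * Y.s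
    + 2 * q ^ 4 * ρ * X.p * X.m * Y.p * Y.s + 2 * q ^ 4 * ρ * X.p ^ 2 * Y.p * Y.s
    + 2 * q ^ 4 * ρ * X.c * X.s * Y.p * Y.s + q ^ 4 * ρ * X.c * X.s * Y.c * Y.s + q ^ 5 * X.p * X.s * Y.p * Y.d
    + q ^ 5 * X.p * X.s * Y.p * Y.m + q ^ 5 * X.p * X.s * Y.p ^ 2 + q ^ 5 * X.p * X.s * Y.c * Y.s
    + q ^ 5 * X.p * X.d * Y.p * Y.s + q ^ 5 * X.p * X.m * Y.p * Y.s + q ^ 5 * X.p ^ 2 * Y.p * Y.s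
    + q ^ 5 * X.c * X.s * Y.p * Y.s + 2 * q ^ 3 * ρ * X.p * X.s * Y.c * Y.d + 2 * q ^ 3 * ρ * X.p * X.s * Y.c * Y.m
    + 4 * q ^ 3 * ρ * X.p * X.s * Y.c * Y.p + 2 * q ^ 3 * ρ * X.p * X.d * Y.p * Y.d
    + 2 * q ^ 3 * ρ * X.p * X.d * Y.p * Y.m + 2 * q ^ 3 * ρ * X.p * X.d * Y.p ^ 2
    + 2 * q ^ 3 * ρ * X.p * X.d * Y.c * Y.s + 2 * q ^ 3 * ρ * X.p * X.m * Y.p * Y.d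
    + 2 * q ^ 3 * ρ * X.p * X.m * Y.p * Y.m + 2 * q ^ 3 * ρ * X.p * X.m * Y.p ^ 2
    + 2 * q ^ 3 * ρ * X.p * X.m * Y.c * Y.s + 2 * q ^ 3 * ρ * X.p ^ 2 * Y.p * Y.d
    + 2 * q ^ 3 * ρ * X.p ^ 2 * Y.p * Y.m + 2 * q ^ 3 * ρ * X.p ^ 2 * Y.p ^ 2 + 2 * q ^ 3 * ρ * X.p ^ 2 * Y.c * Y.s
    + 2 * q ^ 3 * ρ * X.c * X.s * Y.p * Y.d + 2 * q ^ 3 * ρ * X.c * X.s * Y.p * Y.m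
    + 2 * q ^ 3 * ρ * X.c * X.s * Y.p ^ 2 + q ^ 3 * ρ * X.c * X.s * Y.c * Y.d + q ^ 3 * ρ * X.c * X.s * Y.c * Y.m
    + q ^ 3 * ρ * X.c * X.s * Y.c * Y.p + 2 * q ^ 3 * ρ * X.c * X.d * Y.p * Y.s + q ^ 3 * ρ * X.c * X.d * Y.c * Y.s
    + 2 * q ^ 3 * ρ * X.c * X.m * Y.p * Y.s + q ^ 3 * ρ * X.c * X.m * Y.c * Y.s
    + 4 * q ^ 3 * ρ * X.c * X.p * Y.p * Y.s + q ^ 3 * ρ * X.c * X.p * Y.c * Y.s + q ^ 4 * X.p * X.s * Y.c * Y.d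
    + q ^ 4 * X.p * X.s * Y.c * Y.m + 2 * q ^ 4 * X.p * X.s * Y.c * Y.p + q ^ 4 * X.p * X.d * Y.p * Y.d
    + q ^ 4 * X.p * X.d * Y.p * Y.m + q ^ 4 * X.p * X.d * Y.p ^ 2 + q ^ 4 * X.p * X.d * Y.c * Y.s
    + q ^ 4 * X.p * X.m * Y.p * Y.d + q ^ 4 * X.p * X.m * Y.p * Y.m + q ^ 4 * X.p * X.m * Y.p ^ 2
    + q ^ 4 * X.p * X.m * Y.c * Y.s

/-- Part 2 of the (171-monomial, nonnegative) remainder in `Frail_qpendW` (chunked for elaboration). [this work] -/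
def FpendWN2 (q ρ : R) (X Y : SVec R) : R :=
  q ^ 4 * X.p ^ 2 * Y.p * Y.d + q ^ 4 * X.p ^ 2 * Y.p * Y.m + q ^ 4 * X.p ^ 2 * Y.p ^ 2 + q ^ 4 * X.p ^ 2 * Y.c * Y.s
    + q ^ 4 * X.c * X.s * Y.p * Y.d + q ^ 4 * X.c * X.s * Y.p * Y.m + q ^ 4 * X.c * X.s * Y.p ^ 2
    + q ^ 4 * X.c * X.s * Y.c * Y.s + q ^ 4 * X.c * X.d * Y.p * Y.s + q ^ 4 * X.c * X.m * Y.p * Y.s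
    + 2 * q ^ 4 * X.c * X.p * Y.p * Y.s + 2 * q ^ 2 * ρ * X.p * X.s * Y.c ^ 2 + 2 * q ^ 2 * ρ * X.p * X.d * Y.c * Y.d
    + 2 * q ^ 2 * ρ * X.p * X.d * Y.c * Y.m + 4 * q ^ 2 * ρ * X.p * X.d * Y.c * Y.p
    + 2 * q ^ 2 * ρ * X.p * X.m * Y.c * Y.d + 2 * q ^ 2 * ρ * X.p * X.m * Y.c * Y.m
    + 4 * q ^ 2 * ρ * X.p * X.m * Y.c * Y.p + 2 * q ^ 2 * ρ * X.p ^ 2 * Y.c * Y.d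
    + 2 * q ^ 2 * ρ * X.p ^ 2 * Y.c * Y.m + 4 * q ^ 2 * ρ * X.p ^ 2 * Y.c * Y.p
    + 2 * q ^ 2 * ρ * X.c * X.s * Y.c * Y.p + q ^ 2 * ρ * X.c * X.s * Y.c ^ 2 + 2 * q ^ 2 * ρ * X.c * X.d * Y.p * Y.d
    + 2 * q ^ 2 * ρ * X.c * X.d * Y.p * Y.m + 2 * q ^ 2 * ρ * X.c * X.d * Y.p ^ 2 + q ^ 2 * ρ * X.c * X.d * Y.c * Y.d
    + q ^ 2 * ρ * X.c * X.d * Y.c * Y.m + q ^ 2 * ρ * X.c * X.d * Y.c * Y.p + 2 * q ^ 2 * ρ * X.c * X.m * Y.p * Y.d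
    + 2 * q ^ 2 * ρ * X.c * X.m * Y.p * Y.m + 2 * q ^ 2 * ρ * X.c * X.m * Y.p ^ 2 + q ^ 2 * ρ * X.c * X.m * Y.c * Y.d
    + q ^ 2 * ρ * X.c * X.m * Y.c * Y.m + q ^ 2 * ρ * X.c * X.m * Y.c * Y.p + 4 * q ^ 2 * ρ * X.c * X.p * Y.p * Y.d
    + 4 * q ^ 2 * ρ * X.c * X.p * Y.p * Y.m + 4 * q ^ 2 * ρ * X.c * X.p * Y.p ^ 2
    + 2 * q ^ 2 * ρ * X.c * X.p * Y.c * Y.s + q ^ 2 * ρ * X.c * X.p * Y.c * Y.d + q ^ 2 * ρ * X.c * X.p * Y.c * Y.m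
    + q ^ 2 * ρ * X.c * X.p * Y.c * Y.p + 2 * q ^ 2 * ρ * X.c ^ 2 * Y.p * Y.s + q ^ 2 * ρ * X.c ^ 2 * Y.c * Y.s
    + q ^ 3 * X.p * X.s * Y.c ^ 2 + q ^ 3 * X.p * X.d * Y.c * Y.d + q ^ 3 * X.p * X.d * Y.c * Y.m
    + 2 * q ^ 3 * X.p * X.d * Y.c * Y.p + q ^ 3 * X.p * X.m * Y.c * Y.d + q ^ 3 * X.p * X.m * Y.c * Y.m
    + 2 * q ^ 3 * X.p * X.m * Y.c * Y.p + q ^ 3 * X.p ^ 2 * Y.c * Y.d + q ^ 3 * X.p ^ 2 * Y.c * Y.m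
    + 2 * q ^ 3 * X.p ^ 2 * Y.c * Y.p + q ^ 3 * X.c * X.s * Y.c * Y.d + q ^ 3 * X.c * X.s * Y.c * Y.m
    + 2 * q ^ 3 * X.c * X.s * Y.c * Y.p

/-- Part 3 of the (171-monomial, nonnegative) remainder in `Frail_qpendW` (chunked for elaboration). [this work] -/
def FpendWN3 (q ρ : R) (X Y : SVec R) : R :=
  q ^ 3 * X.c * X.d * Y.p * Y.d + q ^ 3 * X.c * X.d * Y.p * Y.m + q ^ 3 * X.c * X.d * Y.p ^ 2
    + q ^ 3 * X.c * X.d * Y.c * Y.s + q ^ 3 * X.c * X.m * Y.p * Y.d + q ^ 3 * X.c * X.m * Y.p * Y.m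
    + q ^ 3 * X.c * X.m * Y.p ^ 2 + q ^ 3 * X.c * X.m * Y.c * Y.s + 2 * q ^ 3 * X.c * X.p * Y.p * Y.d
    + 2 * q ^ 3 * X.c * X.p * Y.p * Y.m + 2 * q ^ 3 * X.c * X.p * Y.p ^ 2 + 2 * q ^ 3 * X.c * X.p * Y.c * Y.s
    + q ^ 3 * X.c ^ 2 * Y.p * Y.s + 2 * q * ρ * X.p * X.d * Y.c ^ 2 + 2 * q * ρ * X.p * X.m * Y.c ^ 2
    + 2 * q * ρ * X.p ^ 2 * Y.c ^ 2 + 2 * q * ρ * X.c * X.d * Y.c * Y.p + q * ρ * X.c * X.d * Y.c ^ 2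
    + 2 * q * ρ * X.c * X.m * Y.c * Y.p + q * ρ * X.c * X.m * Y.c ^ 2 + 2 * q * ρ * X.c * X.p * Y.c * Y.d
    + 2 * q * ρ * X.c * X.p * Y.c * Y.m + 6 * q * ρ * X.c * X.p * Y.c * Y.p + q * ρ * X.c * X.p * Y.c ^ 2
    + 2 * q * ρ * X.c ^ 2 * Y.p * Y.d + 2 * q * ρ * X.c ^ 2 * Y.p * Y.m + 2 * q * ρ * X.c ^ 2 * Y.p ^ 2
    + q * ρ * X.c ^ 2 * Y.c * Y.d + q * ρ * X.c ^ 2 * Y.c * Y.m + q * ρ * X.c ^ 2 * Y.c * Y.p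
    + q ^ 2 * X.p * X.d * Y.c ^ 2 + q ^ 2 * X.p * X.m * Y.c ^ 2 + q ^ 2 * X.p ^ 2 * Y.c ^ 2
    + q ^ 2 * X.c * X.s * Y.c ^ 2 + q ^ 2 * X.c * X.d * Y.c * Y.d + q ^ 2 * X.c * X.d * Y.c * Y.m
    + 2 * q ^ 2 * X.c * X.d * Y.c * Y.p + q ^ 2 * X.c * X.m * Y.c * Y.d + q ^ 2 * X.c * X.m * Y.c * Y.m
    + 2 * q ^ 2 * X.c * X.m * Y.c * Y.p + 2 * q ^ 2 * X.c * X.p * Y.c * Y.d + 2 * q ^ 2 * X.c * X.p * Y.c * Y.m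
    + 4 * q ^ 2 * X.c * X.p * Y.c * Y.p + q ^ 2 * X.c ^ 2 * Y.p * Y.d + q ^ 2 * X.c ^ 2 * Y.p * Y.m
    + q ^ 2 * X.c ^ 2 * Y.p ^ 2 + q ^ 2 * X.c ^ 2 * Y.c * Y.s + 2 * ρ * X.c * X.p * Y.c ^ 2
    + 2 * ρ * X.c ^ 2 * Y.c * Y.p + ρ * X.c ^ 2 * Y.c ^ 2 + q * X.c * X.d * Y.c ^ 2 + q * X.c * X.m * Y.c ^ 2
    + 2 * q * X.c * X.p * Y.c ^ 2 + q * X.c ^ 2 * Y.c * Y.d + q * X.c ^ 2 * Y.c * Y.m + 2 * q * X.c ^ 2 * Y.c * Y.p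
    + X.c ^ 2 * Y.c ^ 2

/-- The rail form under a pendant edge at `w` on the first side: `ρ²` times the old form plus a polynomial with nonnegative coefficients (in three chunks). [this work] -/
theorem Frail_qpendW (q ρ : R) (X Y : SVec R) :
    Frail q (qpendW q ρ X) Y = ρ ^ 2 * Frail q X Y + FpendWN1 q ρ X Y + FpendWN2 q ρ X Y + FpendWN3 q ρ X Y := by
  unfold Frail Aq Bq C0q qpendW FpendWN1 FpendWN2 FpendWN3; ring

/-- The rail form after merging the terminals of the first side is a nonnegative multiple of `Aq Y`. [this work] -/
theorem Frail_mergeUW (q : R) (X Y : SVec R) :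
    Frail q (mergeUW X) Y = (q * X.m * X.s + q * X.m * X.d + q * X.p * X.s + q * X.p * X.d + q * X.c * X.s
      + q * X.c * X.d + X.m ^ 2 + 2 * X.p * X.m + X.p ^ 2 + 2 * X.c * X.m + 2 * X.c * X.p + X.c ^ 2) * Aq q Y := by
  unfold Frail Aq Bq C0q mergeUW; ring

/-! ## Positivity of the rail form along the orbit -/

section Cone

variable {P : R → Prop}

set_option maxHeartbeats 400000 in
/-- THEOREM (all-grade rails, algebraic form): the rail form lies in the cone for every pair of sides of the orbit. [this work] -/
theorem Frail_pos (hP : IsPosCone P) {q : R} (hq : P q) {X Y : SVec R} (hX : Orb P q X) (hY : Orb P q Y) :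
    P (Frail q X Y) := by
  obtain ⟨hC, hPp, hM, hDd, hS, hAY, hDY⟩ := goodQ_of_orb hP hq hY
  induction hX with
  | triv => rw [Frail_triv]; exact hAY
  | rung ht hX ih =>
      obtain ⟨hc, hp, hm, hd, hs, hAX, hDX⟩ := goodQ_of_orb hP hq hX
      rw [Frail_rungStep]
      refine hP.add (hP.add (hP.add (hP.add ih (hP.mul ?_ hAX)) (hP.mul ?_ hAY)) (hP.mul ?_ hDY)) ?_
      all_goals (clear ih hAX hDX hAY hDY; apply_rules (maxDepth := 3000) [hP.add, hP.mul, hP.pow, hP.zero, hP.one, hP.ofNat])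
  | pendU hρ hX ih =>
      rw [Frail_qpendU]
      refine hP.mul ?_ ih
      clear ih hAY hDY; apply_rules (maxDepth := 3000) [hP.add, hP.mul, hP.pow, hP.zero, hP.one, hP.ofNat]
  | @pendW ρ X hρ hX ih =>
      obtain ⟨hc, hp, hm, hd, hs, -, -⟩ := goodQ_of_orb hP hq hX
      have h1 : P (FpendWN1 q ρ X Y) := by clear ih hAY hDY; unfold FpendWN1; apply_rules (maxDepth := 3000) [hP.add, hP.mul, hP.pow, hP.zero, hP.one, hP.ofNat]
      have h2 : P (FpendWN2 q ρ X Y) := by clear ih hAY hDY h1; unfold FpendWN2; apply_rules (maxDepth := 3000) [hP.add, hP.mul, hP.pow, hP.zero, hP.one, hP.ofNat]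
      have h3 : P (FpendWN3 q ρ X Y) := by clear ih hAY hDY h1 h2; unfold FpendWN3; apply_rules (maxDepth := 3000) [hP.add, hP.mul, hP.pow, hP.zero, hP.one, hP.ofNat]
      rw [Frail_qpendW]
      exact hP.add (hP.add (hP.add (hP.mul (hP.pow hρ 2) ih) h1) h2) h3
  | merge hX ih =>
      obtain ⟨hc, hp, hm, hd, hs, -, -⟩ := goodQ_of_orb hP hq hX
      rw [Frail_mergeUW]
      refine hP.mul ?_ hAY
      clear ih hAY hDY; apply_rules (maxDepth := 3000) [hP.add, hP.mul, hP.pow, hP.zero, hP.one, hP.ofNat]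

/-- THEOREM L∞-rail (cone form): for the rail pair `(av, u_ju_{j+1})` of `L_r + av` — apex side = ladder side from `a` with `j`
columns, then the rung `u_jw_j` (weight `t`), then the rail `w_jw_{j+1}` (weight `ρ`, a q-pendant edge at `w`); other side = ladder
side from `v`, then the rung `u_{j+1}w_{j+1}` (weight `t'`) — the all-grade form `P_{av,u_ju_{j+1}}/q³` lies in the cone. [this work] -/
theorem rail_allGrades (hP : IsPosCone P) {q ρ t t' y₁ y₂ z₁ z₂ : R} (hq : P q) (hρ : P ρ) (ht : P t) (ht' : P t')
    (hy₁ : P y₁) (hy₂ : P y₂) (hz₁ : P z₁) (hz₂ : P z₂) (cols cols' : List (R × R × R))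
    (h : ∀ trr ∈ cols, P trr.1 ∧ P trr.2.1 ∧ P trr.2.2) (h' : ∀ trr ∈ cols', P trr.1 ∧ P trr.2.1 ∧ P trr.2.2) :
    P (Frail q (qpendW q ρ (rungStep t (qseg q y₁ y₂ cols))) (rungStep t' (qseg q z₁ z₂ cols'))) :=
  Frail_pos hP hq (Orb.pendW hρ (Orb.rung ht (orb_qseg hy₁ hy₂ cols h))) (Orb.rung ht' (orb_qseg hz₁ hz₂ cols' h'))

end Cone

/-! ## The two headline instances (rails) -/

section Real

variable {S : Type*} [CommRing S] [LinearOrder S] [IsStrictOrderedRing S]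

/-- THEOREM L∞-rail, real form: for every `q ≥ 0` and nonnegative weights the two-copy core `P_{L_r+av; av, u_ju_{j+1}}(q;y)/q³`
is `≥ 0` — Rayleigh negative correlation of the apex edge with every rail at every `0 < q < 1`, all `r, j`. [this work] -/
theorem rail_allq_nonneg {q ρ t t' y₁ y₂ z₁ z₂ : S} (hq : 0 ≤ q) (hρ : 0 ≤ ρ) (ht : 0 ≤ t) (ht' : 0 ≤ t')
    (hy₁ : 0 ≤ y₁) (hy₂ : 0 ≤ y₂) (hz₁ : 0 ≤ z₁) (hz₂ : 0 ≤ z₂) (cols cols' : List (S × S × S))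
    (h : ∀ trr ∈ cols, 0 ≤ trr.1 ∧ 0 ≤ trr.2.1 ∧ 0 ≤ trr.2.2) (h' : ∀ trr ∈ cols', 0 ≤ trr.1 ∧ 0 ≤ trr.2.1 ∧ 0 ≤ trr.2.2) :
    0 ≤ Frail q (qpendW q ρ (rungStep t (qseg q y₁ y₂ cols))) (rungStep t' (qseg q z₁ z₂ cols')) :=
  rail_allGrades (P := fun x : S => 0 ≤ x) isPosCone_nonneg hq hρ ht ht' hy₁ hy₂ hz₁ hz₂ cols cols' h h'

end Real

section Graded

variable {S : Type*} [CommRing S] [LinearOrder S] [IsStrictOrderedRing S]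

open Polynomial

/-- THEOREM L∞-rail, graded form: every coefficient (in `q = X`) of the rail form is `≥ 0` — the CONJ-L edge shadow
`H_{L_r}([a~v], J_f) ⪰ 0` at all grades for every rail `f` of every ladder. [this work] -/
theorem rail_coeff_nonneg {ρ t t' y₁ y₂ z₁ z₂ : S[X]} (hρ : ∀ n, 0 ≤ ρ.coeff n) (ht : ∀ n, 0 ≤ t.coeff n)
    (ht' : ∀ n, 0 ≤ t'.coeff n) (hy₁ : ∀ n, 0 ≤ y₁.coeff n) (hy₂ : ∀ n, 0 ≤ y₂.coeff n) (hz₁ : ∀ n, 0 ≤ z₁.coeff n)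
    (hz₂ : ∀ n, 0 ≤ z₂.coeff n) (cols cols' : List (S[X] × S[X] × S[X]))
    (h : ∀ trr ∈ cols, (∀ n, 0 ≤ trr.1.coeff n) ∧ (∀ n, 0 ≤ trr.2.1.coeff n) ∧ (∀ n, 0 ≤ trr.2.2.coeff n))
    (h' : ∀ trr ∈ cols', (∀ n, 0 ≤ trr.1.coeff n) ∧ (∀ n, 0 ≤ trr.2.1.coeff n) ∧ (∀ n, 0 ≤ trr.2.2.coeff n)) (n : ℕ) :
    0 ≤ (Frail X (qpendW X ρ (rungStep t (qseg X y₁ y₂ cols))) (rungStep t' (qseg X z₁ z₂ cols'))).coeff n :=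
  rail_allGrades (P := fun p : S[X] => ∀ n, 0 ≤ p.coeff n) isPosCone_coeff (fun n => by rw [coeff_X]; split_ifs <;> norm_num)
    hρ ht ht' hy₁ hy₂ hz₁ hz₂ cols cols' h h' n

end Graded

end TwoCopyLadderAllGrades

end Summit.CriticalPhenomena.PercolationContinuityZ3.Theorems
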